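import Summits.ResolutionOfSingularities.ResolutionOfSingularities.Theorems.EquisingularLiftEquisingularLiftNatTowerBFourPointSteps
import Summits.ResolutionOfSingularities.ResolutionOfSingularities.Theorems.EquisingularLiftEquisingularLiftNatTowerBPointStepsFE
import Summits.ResolutionOfSingularities.ResolutionOfSingularities.Theorems.EquisingularLiftEquisingularLiftNatTowerRoundBTriplePrimeDefs
import HarnessLib

/-!
# [OURS · L1 W4.5(b) · EL♮(3) · WIDTH TABLE D17 «STAGE-0 TOWER BOOKKEEPING», engine (n5) pieces] THE B₄ POINT STEPS ON THE STAGE-0 MOTIVE `INV₀`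

res-L1-w45b-nose-w1 g7 (WIDTH seat D-0157 DOOR 1; desk RULING R82 (A) / R83 (3): the (n5) driver `reachTowerNose₀_of_fact` needs the closures of door τ0
✓ `ReachTowerNose₀` (…DefsE9 p719436) on the carrier-free stage-0 motive `INV₀ G γ T E Es Ns K := Tower.InvB₄ O k θ P q Y Ch FE F₉ Z₉ hZ₉ F₁₀ υ' G γ T E Es Ns K ∧
IsClosed K ∧ K ⊆ closure (K ∖ E) ∧ K ≠ univ` — ✓ `INV₁‴` of …NatTowerBTriplePrimePointStepsFE with the carrier riders `hcar`, `IsLocallyNoetherian F₉` DELETED).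
This module = ✓ `Tower.towerPtRegB₄_invB₁_FE` / ✓ `Tower.towerPtRamB₄_invB₁_FE` (res-L1-w45b-stub-2, p-landed) RE-CUT on `INV₀`, proofs verbatim minus the two
riders: ★ `Tower.towerPtRamB₄_invB₀_FE : TowerPtRamB₄ F₁₀ INV₀` (door τ0's second closure AS IS) and ★ `Tower.towerPtRegB₄_invB₀_FE : TowerPtRegB₄ F₁₀ INV₀`
(the B₄-shaped arms of the re-typed `TowerPtRegB₅` (E9′, desk R83) reduce to it; the designated-member arms are the (n1)/(n2) bricks' business).
OURS; NOT a statement of any manuscript ([Hironaka2017] is a candidate under adjudication, nothing of it is asserted); AI-written, weaker than expert review.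
DEF-FREE; no `sorry`; standard axioms.  `--kind proof --supports stmt-ResolutionOfSingularities-20148 --as helper`, counted 0.  EL♮(3) is NOT proved here.
[folklore; re-cut of ✓ modules]
-/

set_option linter.dupNamespace false -- mandated namespace `Summit.<Summit>.<Problem>` of this single-conjunct summit
set_option linter.overlappingInstances false -- signatures carry `[IsDomain O] [IsDiscreteValuationRing O]`

noncomputable section

open CategoryTheory CategoryTheory.Limits AlgebraicGeometry TopologicalSpace Topology IsLocalRing
open Literature.AlgebraicGeometry.Resolution
open AlgebraicGeometry.Scheme.IdealSheafData
open Summit.ResolutionOfSingularities.ResolutionOfSingularities.Theses.EquisingularLift.Split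

namespace Summit.ResolutionOfSingularities.ResolutionOfSingularities.Cruxes.EquisingularLiftNat.Sections

section PtFE0

variable (O : Type) [CommRing O] [IsDomain O] [IsDiscreteValuationRing O] [IsAdicComplete (IsLocalRing.maximalIdeal O) O]
    [IsAlgClosed (IsLocalRing.ResidueField O)] (k : Type) [Field k]
    (θ : O →+* k) (hθ : Function.Surjective θ)
    (P : Scheme.{0}) [IsIntegral P] (q : P ⟶ Spec (.of O)) [IsProper q] [SmoothOfRelativeDimension 3 q] (Y : Set P)
    (hYsp : Y ⊆ q ⁻¹' {IsLocalRing.closedPoint O}) (hYirr : IsIrreducible Y) (hYcl : IsClosed Y)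
    (hPnoeth : IsLocallyNoetherian P) (hPreg : Scheme.IsRegular P)
    (Ch : ∀ X' : Scheme.{0}, (X' ⟶ P) → Set X' → Prop)
    (hChStep : ∀ (X' X'' : Scheme.{0}) (σ' : X' ⟶ P) (S' : Set X') (C : X'.IdealSheafData) (τ : X'' ⟶ X'),
      Ch X' σ' S' → IsBlowup τ C → Scheme.IsRegular C.subscheme → Flat (C.subschemeι ≫ σ' ≫ q) →
      σ' '' (C.support : Set X') ⊆ {y | ¬ IsGenericPoint y Y} → (C.support : Set X') ∩ (σ' ≫ q) ⁻¹' {IsLocalRing.closedPoint O} ⊆ S' →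
      Ch X'' (τ ≫ σ') (closure (τ ⁻¹' (S' \ (C.support : Set X')))))
    (hChSplit : ∀ (X' : Scheme.{0}) (σ' : X' ⟶ P) (S' : Set X'), Ch X' σ' S' → Chain P Y X' σ' S')

include hθ hYsp hYirr hYcl hPnoeth hPreg hChStep hChSplit

omit [IsIntegral P] [SmoothOfRelativeDimension 3 q] in
/-- ★ **`(pt-reg)` B₄-shaped on the stage-0 motive `INV₀` at `FE`**: ✓ `Tower.towerPtRegB₄_invB₁_FE` minus the carrier riders — a wrapper over res-type-027's
✓ `Tower.invB₄_ptRegStep` plus the K-side facts. [OURS · L1 W4.5b · D17 engine; counted 0; EL♮(3) NOT proved] -/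
theorem Tower.towerPtRegB₄_invB₀_FE :
    ∀ (F₉ : Scheme.{0}) (Z₉ : Set F₉) (hZ₉ : IsClosed Z₉) (F₁₀ : Scheme.{0}) (υ' : F₁₀ ⟶ F₉),
      TowerPtRegB₄ F₁₀ (fun G γ T E Es Ns K =>
        Tower.InvB₄ O k θ P q Y Ch (fun _ _ _ _ _ _ _ _ _ σ _ 𝓔 => Flat (𝓔.subschemeι ≫ σ ≫ q)) F₉ Z₉ hZ₉ F₁₀ υ' G γ T E Es Ns K ∧
          IsClosed K ∧ K ⊆ closure (K \ E) ∧ K ≠ Set.univ) := by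
  intro F₉ Z₉ hZ₉ F₁₀ υ' G G' γ T E Es Ns K y υ₂ hy K' E' Es' Ns' hinv hTreg hGreg hυ₂ hK' hE' hEs' hNs'
  obtain ⟨hinv, hKcl, hKE, hKne⟩ := hinv
  have hI₂ := Tower.invB₄_ptRegStep O k θ hθ P q Y hYsp hYirr hYcl hPnoeth hPreg Ch hChSplit hChStep _ F₉ Z₉ hZ₉ F₁₀ υ'
    (Tower.feIsoC O P q Z₉ hZ₉ υ') (fun _ _ _ _ _ _ _ _ _ _ _ h => h) G G' γ T E Es Ns K y υ₂ hy K' E' Es' Ns' hinv hTreg hGreg hυ₂ hK' hE' hEs' hNs'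
  refine (fun h3 => ⟨hI₂, h3⟩) ?_
  obtain ⟨-, -, hGint, -, hTirr, hEcl, hTE, hEsB, -⟩ := hinv
  obtain ⟨-, -, hG'int, -⟩ := hI₂
  haveI := hGint
  haveI := hG'int
  have hTy : ¬ T ⊆ {curvePt G T y} := not_subset_singleton_of_not_isRegularLocalRing_stalk y hTreg hy
  have hDsupp : ((vanishingIdeal (⟨{curvePt G T y}, hy⟩ : Closeds G) : G.IdealSheafData).support : Set G) = {curvePt G T y} :=
    Scheme.IdealSheafData.coe_support_vanishingIdeal _
  rcases hK' with rfl | ⟨hyK, rfl⟩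
  · exact ⟨isClosed_empty, by simp, Set.empty_ne_univ⟩
  · refine ⟨isClosed_closure, ?_, closure_preimage_ne_univ υ₂ _ hυ₂ K {curvePt G T y} hKcl hKne hy
      (fun h => hTy (h ▸ Set.subset_univ _)) hDsupp.le _ (Set.preimage_mono fun z hz => hz.1)⟩
    rcases hE' with rfl | ⟨-, rfl⟩ | ⟨F, -, -, -, hK0⟩
    · exact closure_preimage_diff_subset_closure_diff_preimage υ₂ K {curvePt G T y}
    · have h := closure_preimage_diff_subset_of_isBlowup υ₂ (vanishingIdeal (⟨{curvePt G T y}, hy⟩ : Closeds G)) hυ₂ K E hEcl hKE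
      rw [hDsupp] at h
      exact h
    · rw [hK0]; exact Set.empty_subset _


/-- ★ **`(pt-ram)` on the stage-0 motive `INV₀` at `FE`** (door τ0's closure `TowerPtRamB₄ F₁₀ INV₀` AS IS): ✓ `Tower.towerPtRamB₄_invB₁_FE` minus the carrier
riders — a wrapper over res-type-027's ✓ `Tower.invB₄_ptRamStep` plus the K-side facts. [OURS · L1 W4.5b · D17 engine; counted 0; EL♮(3) NOT proved] -/
theorem Tower.towerPtRamB₄_invB₀_FE :
    ∀ (F₉ : Scheme.{0}) (Z₉ : Set F₉) (hZ₉ : IsClosed Z₉) (F₁₀ : Scheme.{0}) (υ' : F₁₀ ⟶ F₉),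
      TowerPtRamB₄ F₁₀ (fun G γ T E Es Ns K =>
        Tower.InvB₄ O k θ P q Y Ch (fun _ _ _ _ _ _ _ _ _ σ _ 𝓔 => Flat (𝓔.subschemeι ≫ σ ≫ q)) F₉ Z₉ hZ₉ F₁₀ υ' G γ T E Es Ns K ∧
          IsClosed K ∧ K ⊆ closure (K \ E) ∧ K ≠ Set.univ) := by
  intro F₉ Z₉ hZ₉ F₁₀ υ' G G' γ T E Es Ns K y J υ₂ K' E' Es' Ns' hinv hTreg _hGreg hJsupp hJgen hυ₂ hK' hE' hEs' hNs'
  obtain ⟨hinv, hKcl, hKE, hKne⟩ := hinv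
  have hI₂ := Tower.invB₄_ptRamStep O k θ hθ P q Y hYsp hYirr hYcl hPnoeth hPreg Ch hChSplit hChStep _ F₉ Z₉ hZ₉ F₁₀ υ'
    (Tower.feIsoC O P q Z₉ hZ₉ υ') G G' γ T E Es Ns K y J υ₂ K' E' Es' Ns' hinv hTreg hJsupp hJgen hυ₂ hK' hE' hEs' hNs'
  refine (fun h3 => ⟨hI₂, h3⟩) ?_
  obtain ⟨-, -, hGint, -, hTirr, hEcl, hTE, hEsB, -⟩ := hinv
  obtain ⟨-, -, hG'int, -⟩ := hI₂
  haveI := hGint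
  haveI := hG'int
  have hyc : IsClosed ({curvePt G T y} : Set G) := hJsupp ▸ J.support.isClosed
  have hTy : ¬ T ⊆ {curvePt G T y} := not_subset_singleton_of_not_isRegularLocalRing_stalk y hTreg hyc
  rcases hK' with rfl | ⟨hyK, rfl⟩
  · exact ⟨isClosed_empty, by simp, Set.empty_ne_univ⟩
  · refine ⟨isClosed_closure, ?_, closure_preimage_ne_univ υ₂ _ hυ₂ K {curvePt G T y} hKcl hKne hyc
      (fun h => hTy (h ▸ Set.subset_univ _)) hJsupp.le _ (Set.preimage_mono fun z hz => hz.1)⟩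
    rcases hE' with ⟨-, rfl⟩ | ⟨F, -, -, -, hK0⟩
    · have h := closure_preimage_diff_subset_of_isBlowup υ₂ J hυ₂ K E hEcl hKE
      rw [hJsupp] at h
      exact h
    · rw [hK0]; exact Set.empty_subset _

end PtFE0

end Summit.ResolutionOfSingularities.ResolutionOfSingularities.Cruxes.EquisingularLiftNat.Sections

end
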